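import Mathlib
import Summits.NavierStokesRegularity.NavierStokesRegularity.Theorems.EulerZoomLiouvillePowerGaugeEulerLiouvilleMirrorMomentSupersolution
import Summits.NavierStokesRegularity.NavierStokesRegularity.Theorems.EulerZoomLiouvillePowerGaugeEulerLiouvilleMirrorMomentMonotone
import Summits.NavierStokesRegularity.NavierStokesRegularity.Theorems.EulerZoomLiouvillePowerGaugeEulerLiouvilleMirrorMomentPlaneVanishing
import HarnessLib

/-!
# Crux `EulerZoomLiouville.PowerGaugeEulerLiouville` (stmt-NavierStokesRegularity-19832), line `mirror-moment`, stub M1 — time side, part 3c-i: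
# THE SIGN LAYER IS CHEAP: box volume `O(δ)`, the estimate at fixed `δ, R`, and the limits `δ → 0`, `R → ∞` of the weighted slices

Route №10 `EulerZoomLiouville` (NavierStokesRegularity), crux E, line `mirror-moment`, stub `stub_momentMonotone` (M1).  Seat ns-sfl-p1 g3.
Measure-theoretic odds and ends for the uniform-in-time ledger bound (part 3c-ii): with `Ω = angVortQuot v = ω_θ/r`, `⟨x⟩ = √(1+‖x‖²)`,
`s_δ(z) = sT(z/δ) − sT(−z/δ)` (`sT = Real.smoothTransition`) and `x₃ :=` the coordinate `x 2`,

* `volume_layerBox_le`, `volumeReal_layerBox_le` — `vol(B̄(0,ρ) ∩ {|x₃| ≤ δ}) ≤ 8ρ²δ` (a box, transported through `EuclideanSpace ℝ (Fin 3) ≃ (Fin 3 → ℝ)`);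
* `integral_le_of_le_of_nonneg` — `∫ φ ≤ ∫ g` as soon as `φ ≤ g` a.e. with `g ≥ 0` integrable (no integrability of `φ`);
* `tendsto_oddSwitch_mul` — `P · s_{1/(n+1)}(z) · ω → P |ω|` when `z ω ≥ 0` and `ω = 0` if `z = 0`;
* `tendsto_integral_oddSwitch_mul_angVortQuot` — **`∫ P s_{1/(n+1)}(x₃) Ω → ∫ P |Ω|`** for a continuous profile `0 ≤ P ≤ C` and an
  axisymmetric swirl-free `C³` field with the outgoing sign and `(1+‖x‖)|Ω| ∈ L¹` (dominated convergence; the sign `x₃ Ω ≥ 0` off the axis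
  and the plane vanishing `Ω|_{x₃=0} = 0` of ns-ezl-w2's `…MirrorMomentPlaneVanishing`);
* `tendsto_integral_plateau_mul` — **`∫ sT(2 − (⟨x⟩+c)/(n+1)) ⟨x⟩ |Ω| → ∫ ⟨x⟩ |Ω|`** (dominated convergence, `⟨x⟩ ≤ 1 + ‖x‖`);
* `setIntegral_Ioo_le_mul` — `∫_{(0,T)} f ≤ T c` from `f ≤ c` (no integrability of `f`);
* `integral_weightZ_slab_le` — **THE ESTIMATE AT FIXED `δ, R`**: for a classical swirl-free axisymmetric Euler flow on `[0,T]` with `|v| ≤ B`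
  and the outgoing sign, `∫ Z(T)Ω(T) ≤ ∫ Z(0)Ω(0) + T · vol(B̄(0,2R) ∩ {|x₃| ≤ δ}) · 2B(2R+BT)DL` (balance of part 3a
  `integral_family_mul_angVortQuot_eq_add` + supersolution/domination of part 3b `weightZ_source_le_indicator`).

WHAT THIS IS NOT: not NS, not the crux E — helper `--supports` stmt-19832; 19832 OPEN.  [folklore]
-/

noncomputable section

-- flat `Theorems/<Route><Decl>…` files of one crux share the namespace of the crux (tree convention)
set_option linter.dupNamespace false

open MeasureTheory Set Filter Topology Metric Function
open scoped NNReal ENNReal RealInnerProductSpace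

namespace Summit.NavierStokesRegularity.NavierStokesRegularity.Theorems.PowerGaugeEulerLiouville.MirrorMoment

open Literature.Analysis Literature.Analysis.FluidPDE

/-! ### The layer box -/

/-- The layer box `B̄(0,ρ) ∩ {|x₃| ≤ δ}` is measurable. [folklore] -/
theorem measurableSet_layerBox (ρ δ : ℝ) :
    MeasurableSet (closedBall (0 : EuclideanSpace ℝ (Fin 3)) ρ ∩ {x | |x 2| ≤ δ}) :=
  measurableSet_closedBall.inter
    (measurableSet_le ((EuclideanSpace.proj (𝕜 := ℝ) (2 : Fin 3)).continuous.measurable.abs) measurable_const)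

/-- **The sign layer is thin**: `vol(B̄(0,ρ) ∩ {|x₃| ≤ δ}) ≤ 8ρ²δ` — the set lies in the box `[−ρ,ρ]² × [−δ,δ]` (pattern of
`Literature.Analysis.FluidPDE.volume_thinCylinder_le`). [folklore] -/
theorem volume_layerBox_le {ρ : ℝ} (hρ : 0 ≤ ρ) (δ : ℝ) :
    volume (closedBall (0 : EuclideanSpace ℝ (Fin 3)) ρ ∩ {x | |x 2| ≤ δ}) ≤ ENNReal.ofReal (8 * ρ ^ 2 * δ) := by
  set lo : Fin 3 → ℝ := ![-ρ, -ρ, -δ] with hlo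
  set hi : Fin 3 → ℝ := ![ρ, ρ, δ] with hhi
  have hsub : closedBall (0 : EuclideanSpace ℝ (Fin 3)) ρ ∩ {x | |x 2| ≤ δ} ⊆
      (WithLp.ofLp : EuclideanSpace ℝ (Fin 3) → (Fin 3 → ℝ)) ⁻¹' Icc lo hi := by
    rintro x ⟨h1, h2⟩
    rw [mem_closedBall_zero_iff] at h1
    have hx0 : |x 0| ≤ ρ := by
      have h := PiLp.norm_apply_le x 0
      rw [Real.norm_eq_abs] at h
      exact h.trans h1
    have hx1 : |x 1| ≤ ρ := by
      have h := PiLp.norm_apply_le x 1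
      rw [Real.norm_eq_abs] at h
      exact h.trans h1
    have hx2 : |x 2| ≤ δ := h2
    rw [mem_preimage, mem_Icc]
    refine ⟨fun i => ?_, fun i => ?_⟩
    · fin_cases i
      · simpa [hlo] using (abs_le.1 hx0).1
      · simpa [hlo] using (abs_le.1 hx1).1
      · simpa [hlo] using (abs_le.1 hx2).1
    · fin_cases i
      · simpa [hhi] using (abs_le.1 hx0).2
      · simpa [hhi] using (abs_le.1 hx1).2
      · simpa [hhi] using (abs_le.1 hx2).2
  have hpres := PiLp.volume_preserving_ofLp (Fin 3)
  calc volume (closedBall (0 : EuclideanSpace ℝ (Fin 3)) ρ ∩ {x | |x 2| ≤ δ})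
      ≤ volume ((WithLp.ofLp : EuclideanSpace ℝ (Fin 3) → (Fin 3 → ℝ)) ⁻¹' Icc lo hi) := measure_mono hsub
    _ = volume (Icc lo hi) := hpres.measure_preimage measurableSet_Icc.nullMeasurableSet
    _ = ENNReal.ofReal (8 * ρ ^ 2 * δ) := by
        rw [Real.volume_Icc_pi, Fin.prod_univ_three]
        simp only [hlo, hhi, Matrix.cons_val_zero, Matrix.cons_val_one, Matrix.cons_val_two, Matrix.head_cons, Matrix.tail_cons]
        rw [← ENNReal.ofReal_mul (by linarith), ← ENNReal.ofReal_mul (by nlinarith)]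
        congr 1
        ring

/-- `vol.real(B̄(0,ρ) ∩ {|x₃| ≤ δ}) ≤ 8ρ²δ`. [folklore] -/
theorem volumeReal_layerBox_le {ρ δ : ℝ} (hρ : 0 ≤ ρ) (hδ : 0 ≤ δ) :
    volume.real (closedBall (0 : EuclideanSpace ℝ (Fin 3)) ρ ∩ {x | |x 2| ≤ δ}) ≤ 8 * ρ ^ 2 * δ :=
  ENNReal.toReal_le_of_le_ofReal (by positivity) (volume_layerBox_le hρ δ)

/-! ### An integral comparison without integrability of the smaller function -/

/-- `∫ φ ≤ ∫ g` whenever `φ ≤ g` a.e. and `g ≥ 0` is integrable — if `φ` is not integrable its integral is `0 ≤ ∫ g`. [folklore] -/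
theorem integral_le_of_le_of_nonneg {φ g : EuclideanSpace ℝ (Fin 3) → ℝ} (hg : Integrable g) (hg0 : 0 ≤ᵐ[volume] g)
    (h : φ ≤ᵐ[volume] g) : ∫ x, φ x ≤ ∫ x, g x := by
  by_cases hφ : Integrable φ
  · exact integral_mono_ae hφ hg h
  · rw [integral_undef hφ]
    exact integral_nonneg_of_ae hg0

/-! ### The limit `δ → 0` -/

/-- Pointwise: `P · s_{1/(n+1)}(z) · ω → P |ω|` as `n → ∞`, provided `z ω ≥ 0` and `ω = 0` when `z = 0` (for `z > 0` the switch is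
eventually `1` and `ω ≥ 0`; for `z < 0` eventually `−1` and `ω ≤ 0`). [folklore] -/
theorem tendsto_oddSwitch_mul {z ω : ℝ} (P : ℝ) (hsign : 0 ≤ z * ω) (hplane : z = 0 → ω = 0) :
    Tendsto (fun n : ℕ => P * (Real.smoothTransition (z / (1 / ((n : ℝ) + 1))) - Real.smoothTransition (-z / (1 / ((n : ℝ) + 1)))) * ω)
      atTop (𝓝 (P * |ω|)) := by
  have hδ : ∀ n : ℕ, (0 : ℝ) < 1 / ((n : ℝ) + 1) := fun n => by positivity
  rcases lt_trichotomy z 0 with hz | hz | hz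
  · have hω : ω ≤ 0 := by
      by_contra h
      rw [not_le] at h
      nlinarith
    obtain ⟨N, hN⟩ := exists_nat_one_div_lt (show (0 : ℝ) < -z by linarith)
    refine tendsto_const_nhds.congr' ((eventually_ge_atTop N).mono fun n hn => ?_)
    have hle : 1 / ((n : ℝ) + 1) ≤ -z :=
      ((one_div_le_one_div_of_le (by positivity) (by exact_mod_cast Nat.succ_le_succ hn)).trans hN.le)
    dsimp only
    rw [oddSwitch_eq_neg_one (δ := 1 / ((n : ℝ) + 1)) (z := z) (hδ n) (by linarith), abs_of_nonpos hω]
    ring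
  · subst hz
    rw [hplane rfl]
    simp
  · have hω : 0 ≤ ω := by
      by_contra h
      rw [not_le] at h
      nlinarith
    obtain ⟨N, hN⟩ := exists_nat_one_div_lt hz
    refine tendsto_const_nhds.congr' ((eventually_ge_atTop N).mono fun n hn => ?_)
    have hle : 1 / ((n : ℝ) + 1) ≤ z :=
      ((one_div_le_one_div_of_le (by positivity) (by exact_mod_cast Nat.succ_le_succ hn)).trans hN.le)
    dsimp only
    rw [oddSwitch_eq_one (δ := 1 / ((n : ℝ) + 1)) (z := z) (hδ n) hle, abs_of_nonneg hω]
    ring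

/-- **The limit `δ → 0` of the weighted slices.**  For a continuous profile `0 ≤ P ≤ C` and an axisymmetric swirl-free `C³` field `v` with the
outgoing sign `0 ≤ x₃ · swirl(curl v)` and `(1+‖x‖)|Ω| ∈ L¹`:  `∫ P(x) s_{1/(n+1)}(x₃) Ω(x) dx → ∫ P(x) |Ω(x)| dx`
(dominated convergence with the bound `C (1+‖x‖)|Ω|`; pointwise by `x₃ Ω ≥ 0` off the axis and `Ω = 0` on the mirror plane). [folklore] -/
theorem tendsto_integral_oddSwitch_mul_angVortQuot {v : EuclideanSpace ℝ (Fin 3) → EuclideanSpace ℝ (Fin 3)} (hv : ContDiff ℝ 3 v)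
    (hax : IsAxisymmetric v) (hsw : HasNoSwirl v) (hout : ∀ y : EuclideanSpace ℝ (Fin 3), 0 ≤ y 2 * swirl (curl v) y)
    (hint : Integrable fun x : EuclideanSpace ℝ (Fin 3) => (1 + ‖x‖) * |angVortQuot v x|)
    {P : EuclideanSpace ℝ (Fin 3) → ℝ} (hP : Continuous P) {C : ℝ} (hP0 : ∀ x, 0 ≤ P x) (hPC : ∀ x, P x ≤ C) :
    Tendsto (fun n : ℕ => ∫ x : EuclideanSpace ℝ (Fin 3),
        P x * (Real.smoothTransition (x 2 / (1 / ((n : ℝ) + 1))) - Real.smoothTransition (-(x 2) / (1 / ((n : ℝ) + 1)))) * angVortQuot v x)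
      atTop (𝓝 (∫ x : EuclideanSpace ℝ (Fin 3), P x * |angVortQuot v x|)) := by
  have hΩc : Continuous (angVortQuot v) := continuous_angVortQuot hv
  refine tendsto_integral_of_dominated_convergence (fun x => C * ((1 + ‖x‖) * |angVortQuot v x|)) (fun n => ?_) (hint.const_mul C)
    (fun n => Eventually.of_forall fun x => ?_) ?_
  · refine (Continuous.mul (hP.mul ?_) hΩc).aestronglyMeasurable
    have h2 : Continuous fun x : EuclideanSpace ℝ (Fin 3) => x 2 := (EuclideanSpace.proj (𝕜 := ℝ) (2 : Fin 3)).continuous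
    exact (Real.smoothTransition.continuous.comp (h2.div_const _)).sub (Real.smoothTransition.continuous.comp (h2.neg.div_const _))
  · rw [Real.norm_eq_abs, abs_mul, abs_mul, abs_of_nonneg (hP0 x)]
    have hs := abs_oddSwitch_le_one (1 / ((n : ℝ) + 1)) (x 2)
    have hΩ0 := abs_nonneg (angVortQuot v x)
    have hC : 0 ≤ C := (hP0 x).trans (hPC x)
    calc P x * |Real.smoothTransition (x 2 / (1 / ((n : ℝ) + 1))) - Real.smoothTransition (-(x 2) / (1 / ((n : ℝ) + 1)))| * |angVortQuot v x|
        ≤ C * 1 * |angVortQuot v x| := mul_le_mul_of_nonneg_right (mul_le_mul (hPC x) hs (abs_nonneg _) hC) hΩ0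
      _ ≤ C * ((1 + ‖x‖) * |angVortQuot v x|) := by
          rw [mul_one]
          exact mul_le_mul_of_nonneg_left (le_mul_of_one_le_left hΩ0 (by linarith [norm_nonneg x])) hC
  · filter_upwards [ae_cylRadius_ne_zero] with x hx
    have hsign : 0 ≤ x 2 * angVortQuot v x := by
      rw [← (axisLedger_dictionary hv hax hsw hout hx).2.1]
      exact mul_nonneg (abs_nonneg _) (div_nonneg (norm_nonneg _) (cylRadius_nonneg x))
    exact tendsto_oddSwitch_mul (P x) hsign fun h0 => angVortQuot_eq_zero_of_apply_two_eq_zero hv hax hout h0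

/-! ### The limit `R → ∞` -/

/-- **The limit `R → ∞` of the plateau.**  For a `C³` field with `(1+‖x‖)|Ω| ∈ L¹` and any real `c`:
`∫ sT(2 − (⟨x⟩ + c)/(n+1)) ⟨x⟩ |Ω| dx → ∫ ⟨x⟩ |Ω| dx` (dominated convergence, `0 ≤ sT ≤ 1`, `⟨x⟩ ≤ 1 + ‖x‖`, `sT(2) = 1`). [folklore] -/
theorem tendsto_integral_plateau_mul {v : EuclideanSpace ℝ (Fin 3) → EuclideanSpace ℝ (Fin 3)} (hv : ContDiff ℝ 3 v)
    (hint : Integrable fun x : EuclideanSpace ℝ (Fin 3) => (1 + ‖x‖) * |angVortQuot v x|) (c : ℝ) :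
    Tendsto (fun n : ℕ => ∫ x : EuclideanSpace ℝ (Fin 3),
        Real.smoothTransition (2 - (Real.sqrt (1 + ‖x‖ ^ 2) + c) / ((n : ℝ) + 1)) * Real.sqrt (1 + ‖x‖ ^ 2) * |angVortQuot v x|)
      atTop (𝓝 (∫ x : EuclideanSpace ℝ (Fin 3), Real.sqrt (1 + ‖x‖ ^ 2) * |angVortQuot v x|)) := by
  have hΩc : Continuous (angVortQuot v) := continuous_angVortQuot hv
  have hbc : Continuous fun x : EuclideanSpace ℝ (Fin 3) => Real.sqrt (1 + ‖x‖ ^ 2) := contDiff_bracket (n := 0) |>.continuous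
  refine tendsto_integral_of_dominated_convergence (fun x => (1 + ‖x‖) * |angVortQuot v x|) (fun n => ?_) hint
    (fun n => Eventually.of_forall fun x => ?_) (Eventually.of_forall fun x => ?_)
  · refine (Continuous.mul (Continuous.mul ?_ hbc) hΩc.abs).aestronglyMeasurable
    exact Real.smoothTransition.continuous.comp (continuous_const.sub ((hbc.add continuous_const).div_const _))
  · obtain ⟨hb1, -, hle⟩ := bracket_bounds x
    have hΩ0 := abs_nonneg (angVortQuot v x)
    rw [Real.norm_of_nonneg (mul_nonneg (mul_nonneg (Real.smoothTransition.nonneg _) (by linarith)) hΩ0)]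
    calc Real.smoothTransition (2 - (Real.sqrt (1 + ‖x‖ ^ 2) + c) / ((n : ℝ) + 1)) * Real.sqrt (1 + ‖x‖ ^ 2) * |angVortQuot v x|
        ≤ 1 * (1 + ‖x‖) * |angVortQuot v x| :=
          mul_le_mul_of_nonneg_right (mul_le_mul (Real.smoothTransition.le_one _) hle (by linarith) zero_le_one) hΩ0
      _ = (1 + ‖x‖) * |angVortQuot v x| := by rw [one_mul]
  · have hq : Tendsto (fun n : ℕ => (Real.sqrt (1 + ‖x‖ ^ 2) + c) / ((n : ℝ) + 1)) atTop (𝓝 0) :=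
      tendsto_const_nhds.div_atTop (tendsto_atTop_add_const_right _ _ tendsto_natCast_atTop_atTop)
    have h2 : Tendsto (fun n : ℕ => Real.smoothTransition (2 - (Real.sqrt (1 + ‖x‖ ^ 2) + c) / ((n : ℝ) + 1))) atTop
        (𝓝 (Real.smoothTransition (2 - 0))) :=
      (Real.smoothTransition.continuous.tendsto _).comp (tendsto_const_nhds.sub hq)
    rw [sub_zero, Real.smoothTransition.one_of_one_le (by norm_num : (1 : ℝ) ≤ 2)] at h2
    have h3 := (h2.mul_const (Real.sqrt (1 + ‖x‖ ^ 2))).mul_const |angVortQuot v x|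
    rwa [one_mul] at h3

/-! ### A time integral bounded by a constant, without integrability -/

/-- `∫_{(0,T)} f ≤ T c` whenever `f ≤ c` on `(0,T)` and `c ≥ 0` — if `f` is not integrable the integral is `0`. [folklore] -/
theorem setIntegral_Ioo_le_mul {f : ℝ → ℝ} {T c : ℝ} (hT : 0 ≤ T) (hc : 0 ≤ c) (hf : ∀ τ ∈ Ioo 0 T, f τ ≤ c) :
    ∫ τ in Ioo 0 T, f τ ≤ T * c := by
  by_cases hfi : IntegrableOn f (Ioo 0 T)
  · calc ∫ τ in Ioo 0 T, f τ ≤ ∫ _ in Ioo 0 T, c :=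
          setIntegral_mono_on hfi (integrableOn_const (measure_Ioo_lt_top.ne)) measurableSet_Ioo hf
      _ = T * c := by rw [setIntegral_const, smul_eq_mul, Real.volume_real_Ioo_of_le hT, sub_zero]
  · rw [integral_undef hfi]
    positivity

/-! ### The estimate at fixed `δ`, `R` -/

/-- **The weighted slice functional is almost non-increasing** (fixed `δ, R`).  For a classical swirl-free axisymmetric Euler flow `v` on
`[0, T]` with `|v| ≤ B` and the outgoing sign, a bound `|sT'| ≤ D`, and `L` with `|Ω(σ,x)| ≤ L|x₃|` on `[0,T] × B̄(0,2R)`: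
`∫ Z(T,x) Ω(T,x) dx ≤ ∫ Z(0,x) Ω(0,x) dx + T · vol(B̄(0,2R) ∩ {|x₃| ≤ δ}) · 2B(2R+BT)DL`
— the balance of part 3a, the supersolution inequality of part 3b a.e. on every slice (`x₃ Ω ≥ 0` off the axis), and the layer-box domination
of the source, integrated without any integrability of the source in time. [cite: MajdaBertozziCUP2002, §2.3.3 (2.58)] -/
theorem integral_weightZ_slab_le {T : ℝ} (hT : 0 < T)
    {v : ℝ → EuclideanSpace ℝ (Fin 3) → EuclideanSpace ℝ (Fin 3)} {q : ℝ → EuclideanSpace ℝ (Fin 3) → ℝ}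
    (hv : IsClassicalNSSolutionOn (Icc 0 T) 0 0 v q)
    (hax : ∀ σ ∈ Icc 0 T, IsAxisymmetric (v σ)) (hsw : ∀ σ ∈ Icc 0 T, HasNoSwirl (v σ))
    (hout : ∀ σ ∈ Icc 0 T, ∀ y : EuclideanSpace ℝ (Fin 3), 0 ≤ y 2 * swirl (curl (v σ)) y)
    {B : ℝ} (hB0 : 0 ≤ B) (hB : ∀ σ ∈ Icc 0 T, ∀ y : EuclideanSpace ℝ (Fin 3), ‖v σ y‖ ≤ B)
    {R δ : ℝ} (hR : 0 < R) (hδ : 0 < δ) {D : ℝ} (hD : ∀ t : ℝ, |deriv Real.smoothTransition t| ≤ D) {L : ℝ} (hL0 : 0 ≤ L)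
    (hL : ∀ σ ∈ Icc 0 T, ∀ x ∈ closedBall (0 : EuclideanSpace ℝ (Fin 3)) (2 * R), |angVortQuot (v σ) x| ≤ L * |x 2|) :
    ∫ x : EuclideanSpace ℝ (Fin 3), (Real.smoothTransition (2 - (Real.sqrt (1 + ‖x‖ ^ 2) + B * T) / R) * (Real.sqrt (1 + ‖x‖ ^ 2) + B * (T - T)) * (Real.smoothTransition (x 2 / δ) - Real.smoothTransition (-(x 2) / δ))) * angVortQuot (v T) x ≤
      (∫ x : EuclideanSpace ℝ (Fin 3), (Real.smoothTransition (2 - (Real.sqrt (1 + ‖x‖ ^ 2) + B * 0) / R) * (Real.sqrt (1 + ‖x‖ ^ 2) + B * (T - 0)) * (Real.smoothTransition (x 2 / δ) - Real.smoothTransition (-(x 2) / δ))) * angVortQuot (v 0) x) +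
        T * (volume.real (closedBall (0 : EuclideanSpace ℝ (Fin 3)) (2 * R) ∩ {y | |y 2| ≤ δ}) * (2 * B * (2 * R + B * T) * D * L)) := by
  have hD0 : 0 ≤ D := (abs_nonneg _).trans (hD 0)
  have hU : UniqueDiffOn ℝ (Icc 0 T) := uniqueDiffOn_Icc hT
  -- the weight family is jointly smooth and supported in `B̄(0, 2R)` on the slab
  have hZs : IsSmoothSpaceTimeOn (Icc 0 T) (fun (σ : ℝ) (x : EuclideanSpace ℝ (Fin 3)) => (Real.smoothTransition (2 - (Real.sqrt (1 + ‖x‖ ^ 2) + B * σ) / R) * (Real.sqrt (1 + ‖x‖ ^ 2) + B * (T - σ)) * (Real.smoothTransition (x 2 / δ) - Real.smoothTransition (-(x 2) / δ)))) := (contDiff_weightZ B T R δ).contDiffOn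
  have hK : IsCompact (closedBall (0 : EuclideanSpace ℝ (Fin 3)) (2 * R)) := isCompact_closedBall _ _
  have hZK : ∀ σ ∈ Icc 0 T, ∀ x ∉ closedBall (0 : EuclideanSpace ℝ (Fin 3)) (2 * R), (fun (σ : ℝ) (x : EuclideanSpace ℝ (Fin 3)) => (Real.smoothTransition (2 - (Real.sqrt (1 + ‖x‖ ^ 2) + B * σ) / R) * (Real.sqrt (1 + ‖x‖ ^ 2) + B * (T - σ)) * (Real.smoothTransition (x 2 / δ) - Real.smoothTransition (-(x 2) / δ)))) σ x = 0 :=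
    fun σ hσ x hx => weightZ_eq_zero_of_lt_norm hB0 hσ.1 hR hx
  -- the balance identity of part 3a
  have hbal := integral_family_mul_angVortQuot_eq_add hT hv hax hsw hZs hK hZK (s := 0) (t := T) le_rfl hT.le le_rfl
  beta_reduce at hbal
  -- the source is dominated slice by slice
  set c : ℝ := volume.real (closedBall (0 : EuclideanSpace ℝ (Fin 3)) (2 * R) ∩ {y | |y 2| ≤ δ}) * (2 * B * (2 * R + B * T) * D * L) with hc
  have hc0 : 0 ≤ c := by
    have hT0 : 0 ≤ T := hT.le
    rw [hc]; positivity
  have hslice : ∀ τ ∈ Ioo 0 T, ∫ x : EuclideanSpace ℝ (Fin 3), angVortQuot (v τ) x *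
      (FluidPDE.timeDerivWithin (Icc 0 T) (fun (σ : ℝ) (y : EuclideanSpace ℝ (Fin 3)) => (Real.smoothTransition (2 - (Real.sqrt (1 + ‖y‖ ^ 2) + B * σ) / R) * (Real.sqrt (1 + ‖y‖ ^ 2) + B * (T - σ)) * (Real.smoothTransition (y 2 / δ) - Real.smoothTransition (-(y 2) / δ)))) τ x +
        fderiv ℝ (fun y : EuclideanSpace ℝ (Fin 3) => (Real.smoothTransition (2 - (Real.sqrt (1 + ‖y‖ ^ 2) + B * τ) / R) * (Real.sqrt (1 + ‖y‖ ^ 2) + B * (T - τ)) * (Real.smoothTransition (y 2 / δ) - Real.smoothTransition (-(y 2) / δ)))) x (v τ x)) ≤ c := by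
    intro τ hτ
    have hτ' : τ ∈ Icc 0 T := ⟨hτ.1.le, hτ.2.le⟩
    have hv3 : ContDiff ℝ 3 (v τ) := (hv.contDiff_velocity hτ').of_le (by norm_cast)
    have hmeas := measurableSet_layerBox (2 * R) δ
    have hfin : volume (closedBall (0 : EuclideanSpace ℝ (Fin 3)) (2 * R) ∩ {y | |y 2| ≤ δ}) ≠ ∞ :=
      ((measure_mono inter_subset_left).trans_lt measure_closedBall_lt_top).ne
    have hgi : Integrable (Set.indicator (closedBall (0 : EuclideanSpace ℝ (Fin 3)) (2 * R) ∩ {y | |y 2| ≤ δ})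
        (fun _ => 2 * B * (2 * R + B * T) * D * L)) := (integrableOn_const hfin).integrable_indicator hmeas
    have hT0 : 0 ≤ T := hT.le
    have hg0 : 0 ≤ᵐ[volume] Set.indicator (closedBall (0 : EuclideanSpace ℝ (Fin 3)) (2 * R) ∩ {y | |y 2| ≤ δ})
        (fun _ => 2 * B * (2 * R + B * T) * D * L) :=
      Eventually.of_forall fun x => Set.indicator_nonneg (fun _ _ => by positivity) x
    refine (integral_le_of_le_of_nonneg hgi hg0 ?_).trans_eq ?_
    · filter_upwards [ae_cylRadius_ne_zero] with x hx
      have hsign : 0 ≤ x 2 * angVortQuot (v τ) x := by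
        rw [← (axisLedger_dictionary hv3 (hax τ hτ') (hsw τ hτ') (hout τ hτ') hx).2.1]
        exact mul_nonneg (abs_nonneg _) (div_nonneg (norm_nonneg _) (cylRadius_nonneg x))
      have hdiff : DifferentiableAt ℝ (fun s : ℝ => (Real.smoothTransition (2 - (Real.sqrt (1 + ‖x‖ ^ 2) + B * s) / R) * (Real.sqrt (1 + ‖x‖ ^ 2) + B * (T - s)) * (Real.smoothTransition (x 2 / δ) - Real.smoothTransition (-(x 2) / δ)))) τ :=
        (((contDiff_weightZ B T R δ).differentiable (by simp)).comp (differentiable_id.prodMk (differentiable_const x))).differentiableAt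
      rw [FluidPDE.timeDerivWithin_apply, hdiff.derivWithin (hU τ hτ')]
      exact weightZ_source_le_indicator hB0 hτ'.1 hτ'.2 hR hδ hD hL0 x (v τ x) (hB τ hτ' x) (mul_oddSwitch_nonneg hδ hsign)
        fun hx2 => hL τ hτ' x (mem_closedBall_zero_iff.2 hx2)
    · rw [integral_indicator_const _ hmeas, smul_eq_mul, hc]
  have hIoo := setIntegral_Ioo_le_mul hT.le hc0 hslice
  linarith

end Summit.NavierStokesRegularity.NavierStokesRegularity.Theorems.PowerGaugeEulerLiouville.MirrorMoment

end
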